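import Literature.MathematicalPhysics.QuantumFieldTheory.TwistedPartitionFunction
import Literature.MathematicalPhysics.QuantumFieldTheory.ConstructiveQFTWave0SiteRPProofs
import HarnessLib

/-!
# Reflection positivity through sites for central plaquette insertions: the gluing identity,
# positive semi-definiteness and the Cauchy–Schwarz inequality for inserted partition functions

Topic `Literature/MathematicalPhysics/QuantumFieldTheory`; vocabulary of `TwistedPartitionFunction.lean`
(`insertedWilsonAction ρ t`, `insertedPartitionFunction ρ β L t` — Wilson's lattice gauge theory on the torus
`(ℤ/Lℤ)^d` with a plaquette insertion `t : Plaquette d L → G`, 't Hooft's twisted partition functions being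
the case of centre-valued insertions on coclosed stacks) and of the site-reflection-positivity file
`ConstructiveQFTWave0SiteRPProofs.lean` (namespace `WilsonSiteRP`: the reflection `Θ'`, `t ↦ -t`, in the
hyperplanes THROUGH the time slices `t = 0`, `t = L/2` — `GaugeConfig.negReflect`, which inverts the temporal
link variables and carries the spatial ones along; the classification `IsSitePosPlaq` / `IsSharedPlaq` /
`IsSiteNegPlaq` of the plaquettes into the open positive half, the two hyperplanes, and the rest; the theorem
`integral_siteIntegrand_nonneg`: `0 ≤ ∫ e^{-βS(U)} conj F(Θ'U) F(U) ∏ dU` for `L` even, every real `β` and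
every bounded measurable `F` depending on the links of the closed positive half).

## What is proved (everything; no facts, no definitions of `Prop`s)

T. Kanazawa, *Generalizing the Tomboulis–Yaffe inequality to SU(N) lattice gauge theories and general
classical spin systems*, Ann. Phys. 324 (2009) 1634 (arXiv:0808.3442) [Kanazawa2008], §2 Lemma 2, proves for
ONE vortex `𝒱` (a coclosed stack of plaquettes of one plane) and the vortex-creation observable
`𝒪^{[k]}[𝒱] = exp((β/N) Σ_{p ∈ 𝒱} [Re tr(z^k U_p) - Re tr U_p])` (eq. (12)):
(15) `θ[𝒪^{[k]}[𝒱]] = 𝒪^{[-k]}[𝒱^θ]` ("the orientation of plaquettes are reversed by reflection"),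
(16)–(17) `⟨𝒪^{[k]}[𝒱]⟩ ≤ ⟨𝒪^{[k]}[𝒱] θ[𝒪^{[k]}[𝒱]]⟩^{1/2} = 1` by the Schwarz inequality of reflection
positivity through sites and Lemma 1 (cancellation of opposite twists on homologous stacks).  The tree's
`TwistedPartitionFunctionRPBound.lean` carries this out for one stack.  Here the same three steps are carried
out for an ARBITRARY centre-valued insertion, which is what several simultaneously twisted planes need
('t Hooft's general twist `n_{μν}`, Nucl. Phys. B153 (1979) 141 [tHooft1979Flux] §2 (2.5)–(2.6)):

* `reflectInsertion u` (`uᶿ`): the insertion read through `Θ'` — inverted on temporal plaquettes (their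
  orientation is reversed), carried along on spatial ones (eq. (15) for a general insertion:
  `plaqReIns_negReflect`, `Re tr ρ(u_p (Θ'U)_p) = Re tr ρ(uᶿ_{ϑ'p} U_{ϑ'p})`, central `u`);
* `glueInsertion u v`: `v` on the closed positive half, `uᶿ` on the negative plaquettes;
* `halfObs ρ β u` (`F_u`): the observable `exp(β[Σ_{p pos}(Re tr ρ(u_pU_p) - Re tr ρ(U_p)) +
  ½ Σ_{p shared}(…)])` of the links of the closed positive half — Kanazawa's `𝒪` for a general insertion,
  the plaquettes INSIDE the two reflection hyperplanes (necessarily met by the stacks of spatial planes,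
  which extend over all times) entering with weight `½` in `F_u` and `½` in `θ[F_u]`;
* ★ the GLUING IDENTITY `e^{-βS(U)} F_u(Θ'U) F_v(U) = e^{-β S_{glue(u,v)}(U)}` for central `u, v` agreeing on
  the shared plaquettes (`exp_mul_halfObs_negReflect_mul_halfObs`, `integral_halfObs_negReflect_mul_halfObs`);
* ★ POSITIVE SEMI-DEFINITENESS `0 ≤ Σ_{i,j} conj(a_i) a_j Z_{glue(v_i,v_j)}` for every finite family of central
  insertions pairwise agreeing on the shared plaquettes (`sum_sum_glue_nonneg`: reflection positivity applied
  to `F = Σ a_i F_{v_i}`), whence symmetry `Z_{glue(u,v)} = Z_{glue(v,u)}` (`glue_comm`) and ★ the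
  CAUCHY–SCHWARZ INEQUALITY `Z_{glue(u,v)}² ≤ Z_{glue(u,u)} Z_{glue(v,v)}` (`glue_sq_le`).

Scope: any compact Hausdorff group `G` (Borel σ-algebra), any continuous matrix representation `ρ`, any real
`β`, `L` even, `d ≥ 1`; the reflection direction is the coordinate `0` of the tree's site-RP theorem.  The
consequences for 't Hooft's twisted partition functions (removing all twists through one lattice direction
does not decrease `Z`; `Z(z) ≤ Z(1)` for every twist; positive-definiteness of the electric-flux Fourier
transform) are the theorem files importing this one.  HONEST FRAMING: finite-volume lattice statements;
Kanazawa prints the one-vortex case, the general-insertion form is this file's (same proof).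

## References
* T. Kanazawa, Ann. Phys. 324 (2009) 1634–1665, §2 eqs. (12), (15)–(17). [Kanazawa2008]
* G. 't Hooft, Nucl. Phys. B153 (1979) 141–160, §2 eqs. (2.5)–(2.6). [tHooft1979Flux]
* K. Osterwalder, E. Seiler, Ann. Phys. 110 (1978) 440, §2; J. Fröhlich, R. Israel, E. H. Lieb, B. Simon,
  Comm. Math. Phys. 62 (1978) 1, Thm. 2.1 (reflection positivity through sites). [folklore]
-/

open MeasureTheory Finset Complex
open scoped ComplexConjugate ComplexOrder BigOperators

namespace Literature.MathematicalPhysics.QuantumFieldTheory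

noncomputable section

namespace InsertionSiteRP

open WilsonRP WilsonSiteRP

/-! ## The reflected and the glued insertion -/

section Defs

variable {d L : ℕ} [NeZero d] {G : Type*} [Group G]

/-- **The reflected insertion** `uᶿ`: the site reflection `Θ'` (`t ↦ -t`) carries the plaquette `p` to
`ϑ'p` (`WilsonSiteRP.sitePlaqReflect`), reversing the orientation of the temporal plaquettes and
preserving that of the spatial ones; accordingly `uᶿ(p) = u(ϑ'p)⁻¹` for temporal `p` (first direction
`0`) and `uᶿ(p) = u(ϑ'p)` for spatial `p` (Kanazawa 2009, Lemma 2 eq. (15): "the orientation of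
plaquettes are reversed by reflection", `θ[𝒪^{[k]}[𝒱]] = 𝒪^{[-k]}[𝒱^θ]`).
[cite: Kanazawa2008, §2 Lemma 2 eq. (15)] -/
def reflectInsertion (u : Plaquette d L → G) : Plaquette d L → G :=
  fun p => if p.2.1.1 = 0 then (u (sitePlaqReflect p))⁻¹ else u (sitePlaqReflect p)

/-- **The glued insertion** of the reflection-positivity sandwich `⟨θ[F_u] F_v⟩`: `v` on the closed
positive half (positive and shared plaquettes of `WilsonSiteRP`), the reflection `uᶿ` of `u` on the
negative plaquettes. [cite: Kanazawa2008, §2 Lemma 2 eqs. (15)–(17)] -/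
def glueInsertion (u v : Plaquette d L → G) : Plaquette d L → G :=
  fun p => if IsSiteNegPlaq p then reflectInsertion u p else v p

/-- The reflected insertion at a temporal plaquette. [cite: Kanazawa2008, §2 Lemma 2 eq. (15)] -/
theorem reflectInsertion_of_eq_zero (u : Plaquette d L → G) {p : Plaquette d L} (hp : p.2.1.1 = 0) :
    reflectInsertion u p = (u (sitePlaqReflect p))⁻¹ := if_pos hp

/-- The reflected insertion at a spatial plaquette. [cite: Kanazawa2008, §2 Lemma 2 eq. (15)] -/
theorem reflectInsertion_of_ne_zero (u : Plaquette d L → G) {p : Plaquette d L} (hp : p.2.1.1 ≠ 0) :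
    reflectInsertion u p = u (sitePlaqReflect p) := if_neg hp

/-- The trivial insertion is its own reflection. [cite: Kanazawa2008, §2 Lemma 2 eq. (15)] -/
@[simp] theorem reflectInsertion_one :
    reflectInsertion (fun _ : Plaquette d L => (1 : G)) = fun _ => 1 := by
  funext p
  unfold reflectInsertion
  split_ifs <;> simp

/-- The reflected insertion takes central values if the insertion does. [folklore] -/
private theorem reflectInsertion_mem_center {u : Plaquette d L → G}
    (hu : ∀ p, u p ∈ Subgroup.center G) (p : Plaquette d L) :
    reflectInsertion u p ∈ Subgroup.center G := by
  unfold reflectInsertion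
  split_ifs
  · exact Subgroup.inv_mem _ (hu _)
  · exact hu _

/-- Reflection of a product of insertions with central values. [cite: Kanazawa2008, §2 Lemma 2 eq. (15)] -/
theorem reflectInsertion_mul {u v : Plaquette d L → G} (hu : ∀ p, u p ∈ Subgroup.center G) :
    reflectInsertion (fun p => u p * v p) = fun p => reflectInsertion u p * reflectInsertion v p := by
  funext p
  unfold reflectInsertion
  split_ifs
  · rw [mul_inv_rev, Subgroup.mem_center_iff.1 (Subgroup.inv_mem _ (hu _))]
  · rfl

/-- The plane of the reflected plaquette is the plane of the plaquette. [folklore] -/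
private theorem sitePlaqReflect_snd (p : Plaquette d L) : (sitePlaqReflect p).2 = p.2 := rfl

/-- `ϑ'` is an involution on insertions: `(uᶿ)ᶿ = u`. [cite: Kanazawa2008, §2 Lemma 2 eq. (15)] -/
theorem reflectInsertion_reflectInsertion (u : Plaquette d L → G) :
    reflectInsertion (reflectInsertion u) = u := by
  funext p
  unfold reflectInsertion
  rw [sitePlaqReflect_snd, sitePlaqReflect_sitePlaqReflect]
  split_ifs <;> simp

/-- The glued insertion on a negative plaquette. [cite: Kanazawa2008, §2 Lemma 2 eqs. (15)–(17)] -/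
theorem glueInsertion_of_neg (u v : Plaquette d L → G) {p : Plaquette d L} (hp : IsSiteNegPlaq p) :
    glueInsertion u v p = reflectInsertion u p := if_pos hp

/-- The glued insertion off the negative plaquettes. [cite: Kanazawa2008, §2 Lemma 2 eqs. (15)–(17)] -/
theorem glueInsertion_of_not_neg (u v : Plaquette d L → G) {p : Plaquette d L}
    (hp : ¬ IsSiteNegPlaq p) : glueInsertion u v p = v p := if_neg hp

/-- The glued insertion takes central values if both insertions do. [folklore] -/
private theorem glueInsertion_mem_center {u v : Plaquette d L → G}
    (hu : ∀ p, u p ∈ Subgroup.center G) (hv : ∀ p, v p ∈ Subgroup.center G) (p : Plaquette d L) :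
    glueInsertion u v p ∈ Subgroup.center G := by
  unfold glueInsertion
  split_ifs
  · exact reflectInsertion_mem_center hu p
  · exact hv p

end Defs

/-! ## Geometry of the site reflection on plaquettes (complements to `WilsonSiteRP`) -/

section Geometry

variable {d L : ℕ} [NeZero d] [NeZero L]

/-- Shared plaquettes are fixed by `ϑ'`. [folklore] -/
private theorem sitePlaqReflect_of_isSharedPlaq (hL : Even L) {p : Plaquette d L}
    (hp : IsSharedPlaq p) : sitePlaqReflect p = p := by
  obtain ⟨x, ij⟩ := p
  obtain ⟨hi, ht⟩ := hp
  unfold sitePlaqReflect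
  simp only at hi ht ⊢
  rw [if_neg hi, negReflect_of_two_mul (two_mul_eq_zero_of_val hL ht)]

/-- Every plaquette is positive, shared or negative, exclusively: the three-way splitting of a sum
over plaquettes. [folklore] -/
private theorem sum_eq_pos_add_shared_add_neg (f : Plaquette d L → ℝ) :
    ∑ p, f p = ∑ p ∈ univ.filter IsSitePosPlaq, f p + ∑ p ∈ univ.filter IsSharedPlaq, f p +
      ∑ p ∈ univ.filter IsSiteNegPlaq, f p := by
  have h1 : ∑ p, f p = ∑ p ∈ univ.filter IsSitePosPlaq, f p +
      ∑ p ∈ univ.filter (fun p => ¬ IsSitePosPlaq p), f p :=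
    (Finset.sum_filter_add_sum_filter_not univ IsSitePosPlaq _).symm
  have h2 : ∑ p ∈ univ.filter (fun p => ¬ IsSitePosPlaq p), f p =
      ∑ p ∈ univ.filter IsSharedPlaq, f p + ∑ p ∈ univ.filter IsSiteNegPlaq, f p := by
    rw [← Finset.sum_filter_add_sum_filter_not (univ.filter fun p => ¬ IsSitePosPlaq p) IsSharedPlaq,
      Finset.filter_filter, Finset.filter_filter]
    have hC : (univ.filter fun p : Plaquette d L => ¬ IsSitePosPlaq p ∧ IsSharedPlaq p) =
        univ.filter IsSharedPlaq :=
      Finset.filter_congr fun p _ => ⟨fun h => h.2, fun h => ⟨not_isSitePosPlaq_of_isSharedPlaq h, h⟩⟩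
    have hN : (univ.filter fun p : Plaquette d L => ¬ IsSitePosPlaq p ∧ ¬ IsSharedPlaq p) =
        univ.filter IsSiteNegPlaq :=
      Finset.filter_congr fun p _ => Iff.rfl
    rw [hC, hN]
  rw [h1, h2, add_assoc]

/-- Re-indexing the negative plaquettes by the reflections of the positive ones. [folklore] -/
private theorem sum_pos_reflect_eq_sum_neg [Fact (1 < L)] (hL : Even L) (f : Plaquette d L → ℝ) :
    ∑ p ∈ univ.filter IsSitePosPlaq, f (sitePlaqReflect p) = ∑ p ∈ univ.filter IsSiteNegPlaq, f p := by
  refine Finset.sum_equiv sitePlaqReflectEquiv (fun p => ?_) (fun p _ => rfl)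
  simp only [Finset.mem_filter, Finset.mem_univ, true_and]
  exact (isSiteNegPlaq_sitePlaqReflect_iff hL p).symm

/-- Re-indexing the shared plaquettes by their (trivial) reflections. [folklore] -/
private theorem sum_shared_reflect_eq (hL : Even L) (f : Plaquette d L → ℝ) :
    ∑ p ∈ univ.filter IsSharedPlaq, f (sitePlaqReflect p) = ∑ p ∈ univ.filter IsSharedPlaq, f p :=
  Finset.sum_congr rfl fun p hp => by
    rw [Finset.mem_filter] at hp
    rw [sitePlaqReflect_of_isSharedPlaq hL hp.2]

variable {G : Type*} [Group G]

/-- On a shared plaquette the reflected insertion is the insertion. [folklore] -/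
private theorem reflectInsertion_of_isSharedPlaq (hL : Even L) (u : Plaquette d L → G)
    {p : Plaquette d L} (hp : IsSharedPlaq p) : reflectInsertion u p = u p := by
  rw [reflectInsertion_of_ne_zero u hp.1, sitePlaqReflect_of_isSharedPlaq hL hp]

end Geometry

/-! ## The inserted plaquette energy and its reflection law -/

section Energy

variable {d L N : ℕ} {G : Type*} [Group G] (ρ : G →* Matrix (Fin N) (Fin N) ℂ)

/-- `Re tr ρ(u_p U_p)`, the plaquette term of the inserted Wilson action. [folklore] -/
def plaqReIns (u : Plaquette d L → G) (U : GaugeConfig d L G) (p : Plaquette d L) : ℝ :=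
  (ρ (u p * plaquetteHolonomy U p.1 p.2.1.1 p.2.1.2)).trace.re

/-- With the trivial insertion, `plaqReIns` is `WilsonRP.plaqRe`. [folklore] -/
private theorem plaqReIns_one (U : GaugeConfig d L G) (p : Plaquette d L) :
    plaqReIns ρ (fun _ => 1) U p = plaqRe ρ U p := by
  simp [plaqReIns, plaqRe]

/-- `plaqReIns` depends on the insertion only through its value at the plaquette. [folklore] -/
private theorem plaqReIns_congr {u w : Plaquette d L → G} {p : Plaquette d L} (h : u p = w p)
    (U : GaugeConfig d L G) : plaqReIns ρ u U p = plaqReIns ρ w U p := by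
  simp only [plaqReIns, h]

/-- The inserted action as `N · #plaquettes - ∑ₚ Re tr ρ(u_p U_p)`. [folklore] -/
private theorem insertedWilsonAction_eq_sub_sum [NeZero L] (u : Plaquette d L → G)
    (U : GaugeConfig d L G) :
    insertedWilsonAction ρ u U = N * Fintype.card (Plaquette d L) - ∑ p, plaqReIns ρ u U p := by
  simp only [insertedWilsonAction, plaqReIns, Finset.sum_sub_distrib, Finset.sum_const,
    Finset.card_univ, nsmul_eq_mul]
  ring

/-- Measurability of the inserted plaquette energy (continuous `ρ`; through the matrix entries, no
countability assumption on `G`). [folklore] -/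
private theorem measurable_plaqReIns [TopologicalSpace G] [IsTopologicalGroup G] [MeasurableSpace G]
    [BorelSpace G] (hρ : Continuous ρ) (u : Plaquette d L → G) (p : Plaquette d L) :
    Measurable fun U : GaugeConfig d L G => plaqReIns ρ u U p := by
  unfold plaqReIns plaquetteHolonomy
  have hconst : EntryMeasurable ρ fun _ : GaugeConfig d L G => u p := fun _ _ => measurable_const
  exact (hconst.mul ((((entryMeasurable_apply hρ _).mul (entryMeasurable_apply hρ _)).mul
    (entryMeasurable_apply_inv hρ _)).mul (entryMeasurable_apply_inv hρ _))).measurable_trace_re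

variable [TopologicalSpace G] [IsTopologicalGroup G] [CompactSpace G]

/-- `|Re tr ρ(u_p U_p)| ≤ N`. [folklore] -/
private theorem abs_plaqReIns_le (hρ : Continuous ρ) (u : Plaquette d L → G) (U : GaugeConfig d L G)
    (p : Plaquette d L) : |plaqReIns ρ u U p| ≤ N := by
  have h := Literature.RepresentationTheory.CompactGroups.CompactGroup.abs_re_trace_le_card ρ hρ
    (u p * plaquetteHolonomy U p.1 p.2.1.1 p.2.1.2)
  rwa [Fintype.card_fin] at h

/-- **Reflection law for inserted plaquette energies** (Kanazawa 2009, Lemma 2 eq. (15)): for an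
insertion `u` with central values, `Re tr ρ(u_p (Θ'U)_p) = Re tr ρ(uᶿ_{ϑ'p} U_{ϑ'p})` — the reflected
temporal holonomy is a conjugate of the inverse of the holonomy of the reflected plaquette (whence the
inverse twist, `Re tr ρ(z h⁻¹) = Re tr ρ(z⁻¹ h)` on a compact group), the reflected spatial holonomy
IS the holonomy of the reflected plaquette. [cite: Kanazawa2008, §2 Lemma 2 eq. (15)] -/
theorem plaqReIns_negReflect [NeZero d] (hρ : Continuous ρ) {u : Plaquette d L → G}
    (hu : ∀ p, u p ∈ Subgroup.center G) (U : GaugeConfig d L G) (p : Plaquette d L) :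
    plaqReIns ρ u U.negReflect p = plaqReIns ρ (reflectInsertion u) U (sitePlaqReflect p) := by
  obtain ⟨x, ⟨⟨i, j⟩, hij⟩⟩ := p
  have hj : j ≠ 0 := plaq_snd_ne_zero (x, ⟨(i, j), hij⟩)
  by_cases hi : i = 0
  · subst hi
    have hrefl : reflectInsertion u (sitePlaqReflect (x, ⟨(0, j), hij⟩)) = (u (x, ⟨(0, j), hij⟩))⁻¹ := by
      rw [reflectInsertion_of_eq_zero u rfl, sitePlaqReflect_sitePlaqReflect]
    unfold plaqReIns
    rw [hrefl]
    generalize hc : u (x, ⟨(0, j), hij⟩) = c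
    have hcc : c ∈ Subgroup.center G := hc ▸ hu _
    have hcomm : ∀ g : G, g * c = c * g := fun g => Subgroup.mem_center_iff.1 hcc g
    have hcomm' : ∀ g : G, g * c⁻¹ = c⁻¹ * g := fun g =>
      Subgroup.mem_center_iff.1 (Subgroup.inv_mem _ hcc) g
    have key : ∀ g h k l : G,
        c * (g⁻¹ * l * k⁻¹⁻¹ * h⁻¹) = g⁻¹ * ((g * h * k⁻¹ * l⁻¹) * c⁻¹)⁻¹ * g⁻¹⁻¹ := by
      intro g h k l
      calc c * (g⁻¹ * l * k⁻¹⁻¹ * h⁻¹) = (c * g⁻¹) * (l * k * h⁻¹) := by group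
        _ = (g⁻¹ * c) * (l * k * h⁻¹) := by rw [hcomm]
        _ = g⁻¹ * ((g * h * k⁻¹ * l⁻¹) * c⁻¹)⁻¹ * g⁻¹⁻¹ := by group
    unfold sitePlaqReflect plaquetteHolonomy
    simp only [negReflect_apply, siteEdgeReflect, hj, ↓reduceIte]
    rw [negReflect_shift_shift_zero _ hj, ← negReflect_shift_shift x, key,
      Literature.RepresentationTheory.CompactGroups.CompactGroup.trace_conj_eq,
      Literature.RepresentationTheory.CompactGroups.CompactGroup.re_trace_map_inv ρ hρ, hcomm']
  · have hrefl : reflectInsertion u (sitePlaqReflect (x, ⟨(i, j), hij⟩)) = u (x, ⟨(i, j), hij⟩) := by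
      rw [reflectInsertion_of_ne_zero u (show (sitePlaqReflect (x, ⟨(i, j), hij⟩)).2.1.1 ≠ 0 from hi),
        sitePlaqReflect_sitePlaqReflect]
    unfold plaqReIns
    rw [hrefl]
    unfold sitePlaqReflect plaquetteHolonomy
    simp only [negReflect_apply, siteEdgeReflect, hj, hi, ↓reduceIte]
    rw [negReflect_shift_of_ne _ hi, negReflect_shift_of_ne _ hj]

end Energy


/-! ## The half observable and the gluing identity -/

section Gluing

variable {d L N : ℕ} [NeZero d] [NeZero L] {G : Type*} [Group G]
  (ρ : G →* Matrix (Fin N) (Fin N) ℂ)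

/-- The exponent of the half observable: `β [∑_{p positive} (Re tr ρ(u_p U_p) - Re tr ρ(U_p)) +
½ ∑_{p shared} (Re tr ρ(u_p U_p) - Re tr ρ(U_p))]` — the change of the Wilson weight produced by the
insertion `u` on the positive plaquettes, and HALF of it on the plaquettes inside the two reflection
hyperplanes (the other half is supplied by the reflected factor). [cite: Kanazawa2008, §2 eq. (12) and Lemma 2 eq. (17)] -/
def halfExponent (β : ℝ) (u : Plaquette d L → G) (U : GaugeConfig d L G) : ℝ :=
  β * (∑ p ∈ univ.filter IsSitePosPlaq, (plaqReIns ρ u U p - plaqRe ρ U p) +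
    (1 / 2 : ℝ) * ∑ p ∈ univ.filter IsSharedPlaq, (plaqReIns ρ u U p - plaqRe ρ U p))

/-- **The half observable** `F_u = exp(halfExponent)`: Kanazawa's vortex-creation observable
`𝒪 = exp((β/N) ∑_{p ∈ 𝒱} [Re tr(z U_p) - Re tr U_p])` (2009, eq. (12)) for a general central insertion
supported in the closed positive half, the shared plaquettes entering with weight `½`. A function of the
links of the closed positive half only. [cite: Kanazawa2008, §2 eq. (12)] -/
def halfObs (β : ℝ) (u : Plaquette d L → G) (U : GaugeConfig d L G) : ℝ :=
  Real.exp (halfExponent ρ β u U)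

/-- The half observable is positive. [folklore] -/
private theorem halfObs_pos (β : ℝ) (u : Plaquette d L → G) (U : GaugeConfig d L G) :
    0 < halfObs ρ β u U := Real.exp_pos _

/-- `1 < L` for an even non-zero `L`. [folklore] -/
private theorem one_lt_of_even (hL : Even L) : 1 < L := by
  obtain ⟨r, hr⟩ := hL
  have := NeZero.ne L
  omega

omit [NeZero L] in
/-- Positive plaquettes are not negative. [folklore] -/
private theorem not_isSiteNegPlaq_of_isSitePosPlaq {p : Plaquette d L} (hp : IsSitePosPlaq p) :
    ¬ IsSiteNegPlaq p := fun h => h.1 hp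

omit [NeZero L] in
/-- Shared plaquettes are not negative. [folklore] -/
private theorem not_isSiteNegPlaq_of_isSharedPlaq {p : Plaquette d L} (hp : IsSharedPlaq p) :
    ¬ IsSiteNegPlaq p := fun h => h.2 hp

variable [TopologicalSpace G] [IsTopologicalGroup G] [CompactSpace G]

/-- **The gluing identity** (pointwise): for central insertions `u`, `v` agreeing on the shared
plaquettes, `e^{-β S(U)} · F_u(Θ'U) · F_v(U) = e^{-β S_{glue(u,v)}(U)}` — the reflected half observable
supplies the weight of the reflected insertion `uᶿ` on the negative plaquettes (Kanazawa 2009, proof of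
Lemma 2: `𝒪^{[k]}[𝒱] θ[𝒪^{[k]}[𝒱]] = 𝒪^{[k]}[𝒱] 𝒪^{[-k]}[𝒱^θ]`). [cite: Kanazawa2008, §2 Lemma 2 eqs. (15)–(17)] -/
theorem exp_mul_halfObs_negReflect_mul_halfObs (hL : Even L) (hρ : Continuous ρ) (β : ℝ)
    {u v : Plaquette d L → G} (hu : ∀ p, u p ∈ Subgroup.center G)
    (huv : ∀ p, IsSharedPlaq p → u p = v p) (U : GaugeConfig d L G) :
    Real.exp (-β * wilsonAction ρ U) * (halfObs ρ β u U.negReflect * halfObs ρ β v U) =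
      Real.exp (-(β * insertedWilsonAction ρ (glueInsertion u v) U)) := by
  haveI : Fact (1 < L) := ⟨one_lt_of_even hL⟩
  rw [halfObs, halfObs, ← Real.exp_add, ← Real.exp_add]
  congr 1
  rw [wilsonAction_eq, insertedWilsonAction_eq_sub_sum]
  unfold halfExponent
  have hPos : ∑ p ∈ univ.filter IsSitePosPlaq,
      (plaqReIns ρ u U.negReflect p - plaqRe ρ U.negReflect p) =
      ∑ p ∈ univ.filter IsSiteNegPlaq, (plaqReIns ρ (reflectInsertion u) U p - plaqRe ρ U p) := by
    rw [← sum_pos_reflect_eq_sum_neg hL]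
    refine Finset.sum_congr rfl fun p _ => ?_
    rw [plaqReIns_negReflect ρ hρ hu, plaqRe_negReflect ρ hρ]
  have hSh : ∑ p ∈ univ.filter IsSharedPlaq,
      (plaqReIns ρ u U.negReflect p - plaqRe ρ U.negReflect p) =
      ∑ p ∈ univ.filter IsSharedPlaq, (plaqReIns ρ v U p - plaqRe ρ U p) := by
    calc ∑ p ∈ univ.filter IsSharedPlaq, (plaqReIns ρ u U.negReflect p - plaqRe ρ U.negReflect p)
        = ∑ p ∈ univ.filter IsSharedPlaq, (plaqReIns ρ (reflectInsertion u) U (sitePlaqReflect p) -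
            plaqRe ρ U (sitePlaqReflect p)) :=
          Finset.sum_congr rfl fun p _ => by rw [plaqReIns_negReflect ρ hρ hu, plaqRe_negReflect ρ hρ]
      _ = ∑ p ∈ univ.filter IsSharedPlaq, (plaqReIns ρ (reflectInsertion u) U p - plaqRe ρ U p) :=
          sum_shared_reflect_eq hL (fun p => plaqReIns ρ (reflectInsertion u) U p - plaqRe ρ U p)
      _ = ∑ p ∈ univ.filter IsSharedPlaq, (plaqReIns ρ v U p - plaqRe ρ U p) :=
          Finset.sum_congr rfl fun p hp => by
            rw [Finset.mem_filter] at hp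
            rw [plaqReIns_congr ρ (show reflectInsertion u p = v p by
              rw [reflectInsertion_of_isSharedPlaq hL u hp.2, huv p hp.2])]
  have hglue : ∑ p, plaqReIns ρ (glueInsertion u v) U p =
      ∑ p ∈ univ.filter IsSitePosPlaq, plaqReIns ρ v U p +
        ∑ p ∈ univ.filter IsSharedPlaq, plaqReIns ρ v U p +
        ∑ p ∈ univ.filter IsSiteNegPlaq, plaqReIns ρ (reflectInsertion u) U p := by
    rw [sum_eq_pos_add_shared_add_neg]
    congr 1
    congr 1
    · exact Finset.sum_congr rfl fun p hp => plaqReIns_congr ρ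
        (glueInsertion_of_not_neg u v (not_isSiteNegPlaq_of_isSitePosPlaq (Finset.mem_filter.1 hp).2)) U
    · exact Finset.sum_congr rfl fun p hp => plaqReIns_congr ρ
        (glueInsertion_of_not_neg u v (not_isSiteNegPlaq_of_isSharedPlaq (Finset.mem_filter.1 hp).2)) U
    · exact Finset.sum_congr rfl fun p hp => plaqReIns_congr ρ
        (glueInsertion_of_neg u v (Finset.mem_filter.1 hp).2) U
  rw [hPos, hSh, hglue, sum_eq_pos_add_shared_add_neg (fun p => plaqRe ρ U p)]
  simp only [Finset.sum_sub_distrib]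
  ring

variable [MeasurableSpace G] [BorelSpace G]

/-- **The gluing identity** (integrated): the reflection-positivity sandwich of two half observables
is the inserted partition function of the glued insertion,
`∫ e^{-βS} conj F_u(Θ'U) F_v(U) ∏ dU = Z_{glue(u,v)}`. [cite: Kanazawa2008, §2 Lemma 2 eqs. (15)–(17)] -/
theorem integral_halfObs_negReflect_mul_halfObs (hL : Even L) (hρ : Continuous ρ) (β : ℝ)
    {u v : Plaquette d L → G} (hu : ∀ p, u p ∈ Subgroup.center G)
    (huv : ∀ p, IsSharedPlaq p → u p = v p) :
    ∫ U : GaugeConfig d L G, (Real.exp (-β * wilsonAction ρ U) : ℂ) *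
        (conj ((halfObs ρ β u U.negReflect : ℝ) : ℂ) * ((halfObs ρ β v U : ℝ) : ℂ))
        ∂(LatticeRP.piMeasure (haarProbability G)) =
      (insertedPartitionFunction ρ β L (glueInsertion u v) : ℂ) := by
  have h : ∀ U : GaugeConfig d L G, (Real.exp (-β * wilsonAction ρ U) : ℂ) *
      (conj ((halfObs ρ β u U.negReflect : ℝ) : ℂ) * ((halfObs ρ β v U : ℝ) : ℂ)) =
      ((Real.exp (-(β * insertedWilsonAction ρ (glueInsertion u v) U)) : ℝ) : ℂ) := fun U => by
    rw [Complex.conj_ofReal, ← exp_mul_halfObs_negReflect_mul_halfObs ρ hL hρ β hu huv U]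
    push_cast
    ring
  simp_rw [h]
  rw [integral_complex_ofReal]
  rfl

omit [CompactSpace G] in
/-- Measurability of the half observable. [folklore] -/
private theorem measurable_halfObs (hρ : Continuous ρ) (β : ℝ) (u : Plaquette d L → G) :
    Measurable (halfObs (d := d) (L := L) ρ β u) := by
  unfold halfObs halfExponent
  refine Real.measurable_exp.comp (Measurable.const_mul (Measurable.add ?_ (Measurable.const_mul ?_ _)) β)
  · exact Finset.measurable_sum _ fun p _ => (measurable_plaqReIns ρ hρ u p).sub (measurable_plaqRe ρ hρ p)
  · exact Finset.measurable_sum _ fun p _ => (measurable_plaqReIns ρ hρ u p).sub (measurable_plaqRe ρ hρ p)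

omit [MeasurableSpace G] [BorelSpace G] in
/-- A crude bound on the half exponent: `|halfExponent| ≤ |β| · 3N · #plaquettes`. [folklore] -/
private theorem abs_halfExponent_le (hρ : Continuous ρ) (β : ℝ) (u : Plaquette d L → G)
    (U : GaugeConfig d L G) :
    |halfExponent ρ β u U| ≤ |β| * (3 * N * Fintype.card (Plaquette d L)) := by
  unfold halfExponent
  rw [abs_mul]
  refine mul_le_mul_of_nonneg_left ?_ (abs_nonneg β)
  have hterm : ∀ p : Plaquette d L, |plaqReIns ρ u U p - plaqRe ρ U p| ≤ 2 * N := fun p => by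
    have h1 := abs_plaqReIns_le ρ hρ u U p
    have h2 := abs_plaqRe_le ρ hρ U p
    calc |plaqReIns ρ u U p - plaqRe ρ U p| ≤ |plaqReIns ρ u U p| + |plaqRe ρ U p| := abs_sub _ _
      _ ≤ N + N := add_le_add h1 h2
      _ = 2 * N := by ring
  have hsum : ∀ s : Finset (Plaquette d L),
      |∑ p ∈ s, (plaqReIns ρ u U p - plaqRe ρ U p)| ≤ 2 * N * Fintype.card (Plaquette d L) := fun s =>
    calc |∑ p ∈ s, (plaqReIns ρ u U p - plaqRe ρ U p)| ≤ ∑ p ∈ s, |plaqReIns ρ u U p - plaqRe ρ U p| :=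
          Finset.abs_sum_le_sum_abs _ _
      _ ≤ ∑ _p ∈ s, (2 * N : ℝ) := Finset.sum_le_sum fun p _ => hterm p
      _ ≤ ∑ _p : Plaquette d L, (2 * N : ℝ) :=
          Finset.sum_le_sum_of_subset_of_nonneg (Finset.subset_univ _) fun _ _ _ => by positivity
      _ = 2 * N * Fintype.card (Plaquette d L) := by
          rw [Finset.sum_const, Finset.card_univ, nsmul_eq_mul]; ring
  have hA := hsum (univ.filter IsSitePosPlaq)
  have hB := hsum (univ.filter IsSharedPlaq)
  have hN : (0 : ℝ) ≤ N * Fintype.card (Plaquette d L) := by positivity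
  calc |∑ p ∈ univ.filter IsSitePosPlaq, (plaqReIns ρ u U p - plaqRe ρ U p) +
        1 / 2 * ∑ p ∈ univ.filter IsSharedPlaq, (plaqReIns ρ u U p - plaqRe ρ U p)|
      ≤ |∑ p ∈ univ.filter IsSitePosPlaq, (plaqReIns ρ u U p - plaqRe ρ U p)| +
          |1 / 2 * ∑ p ∈ univ.filter IsSharedPlaq, (plaqReIns ρ u U p - plaqRe ρ U p)| := abs_add_le _ _
    _ ≤ 2 * N * Fintype.card (Plaquette d L) + 1 / 2 * (2 * N * Fintype.card (Plaquette d L)) := by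
        rw [abs_mul, abs_of_pos (by norm_num : (0 : ℝ) < 1 / 2)]
        exact add_le_add hA (mul_le_mul_of_nonneg_left hB (by norm_num))
    _ = 3 * N * Fintype.card (Plaquette d L) := by ring

omit [MeasurableSpace G] [BorelSpace G] in
/-- The half observable is bounded. [folklore] -/
private theorem halfObs_le (hρ : Continuous ρ) (β : ℝ) (u : Plaquette d L → G) (U : GaugeConfig d L G) :
    halfObs ρ β u U ≤ Real.exp (|β| * (3 * N * Fintype.card (Plaquette d L))) :=
  Real.exp_le_exp.2 ((le_abs_self _).trans (abs_halfExponent_le ρ hρ β u U))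

omit [TopologicalSpace G] [IsTopologicalGroup G] [CompactSpace G] [MeasurableSpace G] [BorelSpace G] in
/-- The half observable depends only on the links of the closed positive half. [folklore] -/
private theorem dependsOn_halfObs [Fact (1 < L)] (hL : Even L) (β : ℝ) (u : Plaquette d L → G) :
    DependsOn (halfObs ρ β u)
      ((sitePosEdges ∪ sharedEdges : Finset (Edge d L)) : Set (Edge d L)) := by
  intro U V hUV
  have h : ∀ e, IsSitePosEdge e ∨ IsSharedEdge e → U e = V e := fun e he => hUV e (by
    rcases he with he | he <;> simp [he])
  have hP : ∀ p ∈ univ.filter IsSitePosPlaq, plaqReIns ρ u U p - plaqRe ρ U p =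
      plaqReIns ρ u V p - plaqRe ρ V p := fun p hp => by
    rw [Finset.mem_filter] at hp
    obtain ⟨h1, h2, h3, h4⟩ := edges_of_isSitePosPlaq hL hp.2
    simp only [plaqReIns, plaqRe, plaquetteHolonomy, h _ h1, h _ h2, h _ h3, h _ h4]
  have hS : ∀ p ∈ univ.filter IsSharedPlaq, plaqReIns ρ u U p - plaqRe ρ U p =
      plaqReIns ρ u V p - plaqRe ρ V p := fun p hp => by
    rw [Finset.mem_filter] at hp
    obtain ⟨h1, h2, h3, h4⟩ := edges_of_isSharedPlaq hp.2
    simp only [plaqReIns, plaqRe, plaquetteHolonomy, h _ (Or.inr h1), h _ (Or.inr h2),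
      h _ (Or.inr h3), h _ (Or.inr h4)]
  unfold halfObs halfExponent
  rw [Finset.sum_congr rfl hP, Finset.sum_congr rfl hS]

/-- **Positive semi-definiteness of the glued partition functions** (reflection positivity through
sites, Kanazawa 2009 Lemma 2 for a whole family of insertions): for central insertions `v_i` pairwise
agreeing on the shared plaquettes and complex coefficients `a_i`,
`0 ≤ ∑_{i,j} conj(a_i) a_j Z_{glue(v_i, v_j)}` — it is `⟨θ[F] F⟩ ≥ 0` for `F = ∑_i a_i F_{v_i}`.
[cite: Kanazawa2008, §2 Lemma 2 eqs. (15)–(17)] -/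
theorem sum_sum_glue_nonneg (hL : Even L) (hρ : Continuous ρ) (β : ℝ) {ι : Type*} [Fintype ι]
    {v : ι → Plaquette d L → G} (hv : ∀ i p, v i p ∈ Subgroup.center G)
    (hSh : ∀ i j p, IsSharedPlaq p → v i p = v j p) (a : ι → ℂ) :
    0 ≤ ∑ i, ∑ j, conj (a i) * a j *
      (insertedPartitionFunction ρ β L (glueInsertion (v i) (v j)) : ℂ) := by
  haveI : Fact (1 < L) := ⟨one_lt_of_even hL⟩
  set μ : Measure (GaugeConfig d L G) := LatticeRP.piMeasure (haarProbability G) with hμ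
  set F : GaugeConfig d L G → ℂ := fun U => ∑ i, a i * ((halfObs ρ β (v i) U : ℝ) : ℂ) with hF
  have hFm : Measurable F := Finset.measurable_sum _ fun i _ =>
    (Complex.measurable_ofReal.comp (measurable_halfObs ρ hρ β (v i))).const_mul _
  set B : ℝ := Real.exp (|β| * (3 * N * Fintype.card (Plaquette d L))) with hB
  have hFb : ∀ U, ‖F U‖ ≤ ∑ i, ‖a i‖ * B := fun U => by
    calc ‖F U‖ ≤ ∑ i, ‖a i * ((halfObs ρ β (v i) U : ℝ) : ℂ)‖ := norm_sum_le _ _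
      _ ≤ ∑ i, ‖a i‖ * B := Finset.sum_le_sum fun i _ => by
          rw [norm_mul, Complex.norm_real, Real.norm_eq_abs, abs_of_pos (halfObs_pos ρ β _ U)]
          exact mul_le_mul_of_nonneg_left (halfObs_le ρ hρ β (v i) U) (norm_nonneg _)
  have hFdep : DependsOn F ((sitePosEdges ∪ sharedEdges : Finset (Edge d L)) : Set (Edge d L)) := by
    intro U V hUV
    simp only [hF]
    exact Finset.sum_congr rfl fun i _ => by rw [dependsOn_halfObs ρ hL β (v i) hUV]
  have hRP := integral_siteIntegrand_nonneg ρ hL hρ β hFm hFb hFdep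
  -- expand the sandwich
  have hexp : ∀ U : GaugeConfig d L G, (Real.exp (-β * wilsonAction ρ U) : ℂ) * (conj (F U.negReflect) * F U) =
      ∑ i, ∑ j, conj (a i) * a j * ((Real.exp (-β * wilsonAction ρ U) : ℂ) *
        (conj ((halfObs ρ β (v i) U.negReflect : ℝ) : ℂ) * ((halfObs ρ β (v j) U : ℝ) : ℂ))) := fun U => by
    simp only [hF, map_sum, map_mul, Finset.sum_mul, Finset.mul_sum]
    rw [Finset.sum_comm]
    refine Finset.sum_congr rfl fun i _ => Finset.sum_congr rfl fun j _ => ?_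
    ring
  simp_rw [hexp] at hRP
  have hint : ∀ i j, Integrable (fun U : GaugeConfig d L G => conj (a i) * a j *
      ((Real.exp (-β * wilsonAction ρ U) : ℂ) *
        (conj ((halfObs ρ β (v i) U.negReflect : ℝ) : ℂ) * ((halfObs ρ β (v j) U : ℝ) : ℂ)))) μ := by
    intro i j
    have h : ∀ U : GaugeConfig d L G, (Real.exp (-β * wilsonAction ρ U) : ℂ) *
        (conj ((halfObs ρ β (v i) U.negReflect : ℝ) : ℂ) * ((halfObs ρ β (v j) U : ℝ) : ℂ)) =
        ((Real.exp (-(β * insertedWilsonAction ρ (glueInsertion (v i) (v j)) U)) : ℝ) : ℂ) := fun U => by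
      rw [Complex.conj_ofReal, ← exp_mul_halfObs_negReflect_mul_halfObs ρ hL hρ β (hv i)
        (fun p hp => hSh i j p hp) U]
      push_cast
      ring
    simp_rw [h]
    exact ((integrable_exp_insertedWilsonAction ρ hρ β (glueInsertion (v i) (v j))).ofReal).const_mul _
  have heq : ∫ U : GaugeConfig d L G, ∑ i, ∑ j, conj (a i) * a j *
      ((Real.exp (-β * wilsonAction ρ U) : ℂ) *
        (conj ((halfObs ρ β (v i) U.negReflect : ℝ) : ℂ) * ((halfObs ρ β (v j) U : ℝ) : ℂ))) ∂μ =
      ∑ i, ∑ j, conj (a i) * a j *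
        (insertedPartitionFunction ρ β L (glueInsertion (v i) (v j)) : ℂ) := by
    rw [integral_finsetSum _ fun i _ => integrable_finsetSum _ fun j _ => hint i j]
    refine Finset.sum_congr rfl fun i _ => ?_
    rw [integral_finsetSum _ fun j _ => hint i j]
    refine Finset.sum_congr rfl fun j _ => ?_
    rw [integral_const_mul,
      integral_halfObs_negReflect_mul_halfObs ρ hL hρ β (hv i) (fun p hp => hSh i j p hp)]
  rw [heq] at hRP
  exact hRP

/-- From positive semi-definiteness on two insertions: symmetry `Z_{glue(u,v)} = Z_{glue(v,u)}` and the
Cauchy–Schwarz inequality — the algebra of a `2 × 2` positive semi-definite real matrix. [folklore] -/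
private theorem psd_two {a b c c' : ℝ}
    (h : ∀ x y : ℂ, 0 ≤ conj x * x * (a : ℂ) + conj x * y * (c : ℂ) + conj y * x * (c' : ℂ) +
      conj y * y * (b : ℂ)) (ha : 0 < a) : c = c' ∧ c ^ 2 ≤ a * b := by
  have hsymm : c = c' := by
    have h1 := h 1 Complex.I
    have him := (Complex.nonneg_iff.1 h1).2
    simp only [map_one, one_mul, mul_one, Complex.conj_I, Complex.add_im, Complex.mul_im,
      Complex.ofReal_re, Complex.ofReal_im, Complex.I_re, Complex.I_im, Complex.neg_re, Complex.neg_im,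
      Complex.mul_re] at him
    linarith
  refine ⟨hsymm, ?_⟩
  subst hsymm
  -- real quadratic form `a t² + 2 c t + b ≥ 0` at `t = -c/a`
  have hq : ∀ t : ℝ, 0 ≤ a * t ^ 2 + 2 * c * t + b := fun t => by
    have h1 := h t 1
    have hre := (Complex.nonneg_iff.1 h1).1
    simp only [map_one, one_mul, mul_one, Complex.conj_ofReal, Complex.add_re, Complex.mul_re,
      Complex.ofReal_re, Complex.ofReal_im, mul_zero, sub_zero] at hre
    nlinarith [hre]
  have h2 := hq (-c / a)
  have h3 : a * (-c / a) ^ 2 + 2 * c * (-c / a) + b = (a * b - c ^ 2) / a := by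
    field_simp
    ring
  rw [h3] at h2
  have := (div_nonneg_iff.1 h2)
  rcases this with ⟨h4, -⟩ | ⟨-, h5⟩
  · linarith
  · linarith

/-- The `2 × 2` positive semi-definite form of two insertions. [folklore] -/
private theorem psd_pair (hL : Even L) (hρ : Continuous ρ) (β : ℝ) {u v : Plaquette d L → G}
    (hu : ∀ p, u p ∈ Subgroup.center G) (hv : ∀ p, v p ∈ Subgroup.center G)
    (huv : ∀ p, IsSharedPlaq p → u p = v p) (x y : ℂ) :
    0 ≤ conj x * x * (insertedPartitionFunction ρ β L (glueInsertion u u) : ℂ) +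
      conj x * y * (insertedPartitionFunction ρ β L (glueInsertion u v) : ℂ) +
      conj y * x * (insertedPartitionFunction ρ β L (glueInsertion v u) : ℂ) +
      conj y * y * (insertedPartitionFunction ρ β L (glueInsertion v v) : ℂ) := by
  have h := sum_sum_glue_nonneg ρ hL hρ β (ι := Bool) (v := fun b => if b then v else u)
    (fun b p => by cases b <;> simp [hu p, hv p])
    (fun b b' p hp => by
      cases b <;> cases b' <;> simp [huv p hp])
    (fun b => if b then y else x)
  simpa [Fintype.sum_bool, add_assoc, add_comm, add_left_comm] using h

/-- **Symmetry of the glued partition functions**: `Z_{glue(u,v)} = Z_{glue(v,u)}` for central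
insertions agreeing on the shared plaquettes (the sandwich is Hermitian). [cite: Kanazawa2008, §2 Lemma 2 eqs. (15)–(17)] -/
theorem glue_comm (hL : Even L) (hρ : Continuous ρ) (β : ℝ) {u v : Plaquette d L → G}
    (hu : ∀ p, u p ∈ Subgroup.center G) (hv : ∀ p, v p ∈ Subgroup.center G)
    (huv : ∀ p, IsSharedPlaq p → u p = v p) :
    insertedPartitionFunction ρ β L (glueInsertion u v) =
      insertedPartitionFunction ρ β L (glueInsertion v u) :=
  (psd_two (psd_pair ρ hL hρ β hu hv huv) (insertedPartitionFunction_pos ρ hρ β _)).1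

/-- **The Cauchy–Schwarz inequality for glued partition functions**
`Z_{glue(u,v)}² ≤ Z_{glue(u,u)} · Z_{glue(v,v)}` (Kanazawa 2009, proof of Lemma 2: the Schwarz
inequality `|⟨F⟩| ≤ ⟨F θF⟩^{1/2}` of site reflection positivity), for central insertions `u, v` agreeing
on the shared plaquettes, `L` even, any real `β`, any compact `G`, any continuous `ρ`.
[cite: Kanazawa2008, §2 Lemma 2 eqs. (16)–(17)] -/
theorem glue_sq_le (hL : Even L) (hρ : Continuous ρ) (β : ℝ) {u v : Plaquette d L → G}
    (hu : ∀ p, u p ∈ Subgroup.center G) (hv : ∀ p, v p ∈ Subgroup.center G)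
    (huv : ∀ p, IsSharedPlaq p → u p = v p) :
    insertedPartitionFunction ρ β L (glueInsertion u v) ^ 2 ≤
      insertedPartitionFunction ρ β L (glueInsertion u u) *
        insertedPartitionFunction ρ β L (glueInsertion v v) :=
  (psd_two (psd_pair ρ hL hρ β hu hv huv) (insertedPartitionFunction_pos ρ hρ β _)).2

end Gluing

end InsertionSiteRP

end

end Literature.MathematicalPhysics.QuantumFieldTheory
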